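import Literature.Probability.LatticeModels.ScalingLimitCompactness
import HarnessLib

/-!
# Riemann sums of lattice step functions along a uniformly convergent sequence

Topic `Literature/Probability/LatticeModels` (analytic glue for lattice scaling limits, continuing
`ScalingLimitCompactness.lean`); an instalment of the discharge programme for crit-ising.S18 /
Smirnov's Theorem 2.2 (`Sweep1Proofs.lean`, module docstring §2b, items B1–B2). In §5 of
Smirnov 2010 two passages to the limit are Riemann sums of the lattice observable along axis-
parallel segments: the discrete contour sums of `F_δ/√δ` around lattice rectangles (which vanish
by discrete holomorphicity, and whose limit is `∮ g dz` — Morera), and the increments of the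
primitive `H_δ = Im ∫^δ F_δ²` along staircases (whose limit is `Im ∫ g² dz`). This file proves the
common analytic step once: if `u k → g` uniformly on a compact `K` with `g` continuous on `K`,
`δ_k → 0⁺`, `N_k δ_k → ℓ`, and the sample points `P k t` are within `C δ_k` of the points
`γ (a₀ + t δ_k)` of a unit-speed affine path whose relevant stretch lies in `K`, then
`δ_k ∑_{t < N_k} u k (P k t) → ∫_{a₀}^{a₀+ℓ} g (γ s) ds` (`tendsto_mul_sum_of_tendstoUniformlyOn`).
Everything is elementary and `[folklore]`.

## References

* S. Smirnov, Ann. of Math. 172 (2010) 1435–1467, §5 — bib key `Smirnov2010`.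
-/

noncomputable section

namespace Literature.Probability.LatticeModels

open Filter Topology Metric Set

/-- **Riemann sums along a uniformly convergent sequence of step functions.** Let `K` be compact,
`g` continuous on `K`, `u k → g` uniformly on `K`, `0 < δ k → 0`, `N k * δ k → ℓ ≥ 0`. Let
`γ s = p + s v` with `‖v‖ = 1` and `γ '' [a₀ - m₀, a₀ + ℓ + m₀] ⊆ K` for some margin `m₀ > 0`, and let
the sample points satisfy `P k t ∈ K`, `dist (P k t) (γ (a₀ + t δ_k)) ≤ C δ_k` for `t < N k`. Then
`δ_k ∑_{t<N_k} u k (P k t) → ∫_{a₀}^{a₀+ℓ} g (γ s) ds`. [folklore] -/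
theorem tendsto_mul_sum_of_tendstoUniformlyOn {K : Set ℂ} (hK : IsCompact K) {g : ℂ → ℂ} (hg : ContinuousOn g K)
    {u : ℕ → ℂ → ℂ} (hu : TendstoUniformlyOn u g atTop K)
    {δ : ℕ → ℝ} (hδ0 : ∀ k, 0 < δ k) (hδ : Tendsto δ atTop (𝓝 0))
    {N : ℕ → ℕ} {ℓ : ℝ} (hℓ : 0 ≤ ℓ) (hN : Tendsto (fun k => (N k : ℝ) * δ k) atTop (𝓝 ℓ))
    {p v : ℂ} (hv : ‖v‖ = 1) {a₀ m₀ : ℝ} (hm₀ : 0 < m₀)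
    (hγK : (fun s : ℝ => p + (s : ℂ) * v) '' Icc (a₀ - m₀) (a₀ + ℓ + m₀) ⊆ K)
    {C : ℝ} (hC : 0 ≤ C) {P : ℕ → ℕ → ℂ} (hPK : ∀ k t, t < N k → P k t ∈ K)
    (hP : ∀ k t, t < N k → dist (P k t) (p + ((a₀ + t * δ k : ℝ) : ℂ) * v) ≤ C * δ k) :
    Tendsto (fun k => (δ k : ℂ) * ∑ t ∈ Finset.range (N k), u k (P k t)) atTop
      (𝓝 (∫ s in a₀..(a₀ + ℓ), g (p + (s : ℂ) * v))) := by
  set γ : ℝ → ℂ := fun s => p + (s : ℂ) * v with hγ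
  set f : ℝ → ℂ := fun s => g (γ s) with hf
  -- continuity of `f` on the parameter interval
  have hγc : Continuous γ := by rw [hγ]; fun_prop
  have hγdist : ∀ s s' : ℝ, dist (γ s) (γ s') = |s - s'| := by
    intro s s'
    rw [hγ, Complex.dist_eq]
    simp only [add_sub_add_left_eq_sub, ← sub_mul, norm_mul, hv, mul_one]
    rw [← Complex.ofReal_sub, Complex.norm_real, Real.norm_eq_abs]
  have hfc : ContinuousOn f (Icc (a₀ - m₀) (a₀ + ℓ + m₀)) :=
    hg.comp hγc.continuousOn fun s hs => hγK ⟨s, hs, rfl⟩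
  -- a bound for `g` on `K`
  obtain ⟨Mg, hMg⟩ := hK.exists_bound_of_continuousOn hg
  have hMg0 : 0 ≤ Mg := by
    obtain ⟨s, hs⟩ : (Icc (a₀ - m₀) (a₀ + ℓ + m₀)).Nonempty := ⟨a₀, by constructor <;> linarith⟩
    exact (norm_nonneg _).trans (hMg _ (hγK ⟨s, hs, rfl⟩))
  -- uniform continuity of `g` on `K`
  have hguc := hK.uniformContinuousOn_of_continuous hg
  rw [Metric.tendsto_nhds]
  intro ε hε
  -- the four error budgets
  set ε' : ℝ := ε / (4 * (ℓ + 2) + 4 * (Mg + 1)) with hε'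
  have hε'0 : 0 < ε' := by positivity
  obtain ⟨η, hη, hηuc⟩ := (Metric.uniformContinuousOn_iff.1 hguc) ε' hε'0
  -- eventual conditions
  have e1 : ∀ᶠ k in atTop, ∀ z ∈ K, dist (g z) (u k z) < ε' := (Metric.tendstoUniformlyOn_iff.1 hu) ε' hε'0
  have e2 : ∀ᶠ k in atTop, δ k < η / (C + 1) := hδ.eventually (Iio_mem_nhds (by positivity))
  have e3 : ∀ᶠ k in atTop, dist ((N k : ℝ) * δ k) ℓ < min ε' (min m₀ 1) :=
    (Metric.tendsto_nhds.1 hN) _ (lt_min hε'0 (lt_min hm₀ one_pos))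
  filter_upwards [e1, e2, e3] with k hk1 hk2 hk3
  have hδk := hδ0 k
  rw [Real.dist_eq, lt_min_iff, lt_min_iff] at hk3
  have hNℓ : (N k : ℝ) * δ k ≤ ℓ + m₀ := by linarith [(abs_lt.1 hk3.2.1).2]
  have hN1 : (N k : ℝ) * δ k ≤ ℓ + 1 := by linarith [(abs_lt.1 hk3.2.2).2]
  have hNℓ' : |(N k : ℝ) * δ k - ℓ| < ε' := hk3.1
  have hCδ : C * δ k < η := by
    have : δ k * (C + 1) < η := by rwa [lt_div_iff₀ (by positivity)] at hk2
    nlinarith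
  have hδη : δ k < η := by
    have : δ k * (C + 1) < η := by rwa [lt_div_iff₀ (by positivity)] at hk2
    nlinarith
  -- parameter points
  have hsI : ∀ t : ℕ, t ≤ N k → a₀ + t * δ k ∈ Icc (a₀ - m₀) (a₀ + ℓ + m₀) := by
    intro t ht
    have ht' : (t : ℝ) ≤ N k := by exact_mod_cast ht
    have : (t : ℝ) * δ k ≤ N k * δ k := mul_le_mul_of_nonneg_right ht' hδk.le
    have ht0 : (0 : ℝ) ≤ t * δ k := by positivity
    constructor <;> nlinarith
  -- (1) replace `u k` by `g` at the sample points
  have step1 : ‖(δ k : ℂ) * ∑ t ∈ Finset.range (N k), u k (P k t) - (δ k : ℂ) * ∑ t ∈ Finset.range (N k), g (P k t)‖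
      ≤ (N k * δ k) * ε' := by
    rw [← mul_sub, ← Finset.sum_sub_distrib, norm_mul, Complex.norm_real, Real.norm_eq_abs, abs_of_pos hδk]
    calc δ k * ‖∑ t ∈ Finset.range (N k), (u k (P k t) - g (P k t))‖
        ≤ δ k * ∑ t ∈ Finset.range (N k), ε' := by
          gcongr
          refine (norm_sum_le _ _).trans (Finset.sum_le_sum fun t ht => ?_)
          have := hk1 (P k t) (hPK k t (Finset.mem_range.1 ht))
          rw [dist_comm, dist_eq_norm] at this
          exact this.le
      _ = (N k * δ k) * ε' := by rw [Finset.sum_const, Finset.card_range, nsmul_eq_mul]; ring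
  -- (2) move the sample points onto the path
  have step2 : ‖(δ k : ℂ) * ∑ t ∈ Finset.range (N k), g (P k t) - (δ k : ℂ) * ∑ t ∈ Finset.range (N k), f (a₀ + t * δ k)‖
      ≤ (N k * δ k) * ε' := by
    rw [← mul_sub, ← Finset.sum_sub_distrib, norm_mul, Complex.norm_real, Real.norm_eq_abs, abs_of_pos hδk]
    calc δ k * ‖∑ t ∈ Finset.range (N k), (g (P k t) - f (a₀ + t * δ k))‖
        ≤ δ k * ∑ t ∈ Finset.range (N k), ε' := by
          gcongr
          refine (norm_sum_le _ _).trans (Finset.sum_le_sum fun t ht => ?_)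
          have htN := Finset.mem_range.1 ht
          have hPt := hPK k t htN
          have hγt : γ (a₀ + t * δ k) ∈ K := hγK ⟨_, hsI t htN.le, rfl⟩
          have hd : dist (P k t) (γ (a₀ + t * δ k)) < η := (hP k t htN).trans_lt hCδ
          have := hηuc (P k t) hPt _ hγt hd
          rw [dist_eq_norm] at this
          exact this.le
      _ = (N k * δ k) * ε' := by rw [Finset.sum_const, Finset.card_range, nsmul_eq_mul]; ring
  -- (3) the Riemann sum of `f`
  have step3 : ‖(δ k : ℂ) * ∑ t ∈ Finset.range (N k), f (a₀ + t * δ k) - ∫ s in a₀..(a₀ + N k * δ k), f s‖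
      ≤ (N k * δ k) * ε' := by
    have hfc' : ContinuousOn f (Icc a₀ (a₀ + N k * δ k)) :=
      hfc.mono (Icc_subset_Icc (by linarith) (by linarith))
    have := norm_sum_smul_sub_integral_le (f := f) (a := a₀) (h := δ k) (ω := ε') (N := N k) hδk.le hfc' ?_
    · rw [Finset.mul_sum]
      calc _ = ‖(∑ t ∈ Finset.range (N k), (δ k : ℂ) * f (a₀ + t * δ k)) - ∫ s in a₀..(a₀ + N k * δ k), f s‖ := rfl
        _ ≤ N k * δ k * ε' := this
    · intro s hs s' hs' hss'
      have hsK : γ s ∈ K := hγK ⟨s, ⟨by linarith [hs.1], by linarith [hs.2]⟩, rfl⟩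
      have hs'K : γ s' ∈ K := hγK ⟨s', ⟨by linarith [hs'.1], by linarith [hs'.2]⟩, rfl⟩
      have hd : dist (γ s) (γ s') < η := by rw [hγdist]; exact hss'.trans_lt hδη
      have := hηuc _ hsK _ hs'K hd
      rw [dist_eq_norm] at this
      exact this.le
  have hNδ0 : 0 ≤ (N k : ℝ) * δ k := by positivity
  -- (4) move the endpoint of the integral
  have step4 : ‖(∫ s in a₀..(a₀ + N k * δ k), f s) - ∫ s in a₀..(a₀ + ℓ), f s‖ ≤ Mg * ε' := by
    have hint1 : IntervalIntegrable f MeasureTheory.volume a₀ (a₀ + ℓ) :=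
      (hfc.mono (by rw [uIcc_of_le (by linarith)]; exact Icc_subset_Icc (by linarith) (by linarith))).intervalIntegrable
    have hint2 : IntervalIntegrable f MeasureTheory.volume (a₀ + ℓ) (a₀ + N k * δ k) := by
      refine (hfc.mono ?_).intervalIntegrable
      rcases le_total (a₀ + ℓ) (a₀ + N k * δ k) with h | h
      · rw [uIcc_of_le h]; exact Icc_subset_Icc (by linarith) (by linarith)
      · rw [uIcc_of_ge h]; exact Icc_subset_Icc (by linarith) (by linarith)
    have key := norm_integral_sub_integral_le (f := f) (M := Mg) hint1 hint2 fun s hs => ?_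
    · calc _ ≤ Mg * |a₀ + N k * δ k - (a₀ + ℓ)| := key
        _ ≤ Mg * ε' := by
            refine mul_le_mul_of_nonneg_left ?_ hMg0
            rw [show a₀ + N k * δ k - (a₀ + ℓ) = N k * δ k - ℓ by ring]; exact hNℓ'.le
    · -- `s` between `a₀ + ℓ` and `a₀ + N δ`: in the parameter interval
      have hs' : s ∈ Icc (a₀ - m₀) (a₀ + ℓ + m₀) := by
        rcases le_total (a₀ + ℓ) (a₀ + N k * δ k) with h | h
        · rw [uIoc_of_le h] at hs; exact ⟨by linarith [hs.1], by linarith [hs.2]⟩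
        · rw [uIoc_of_ge h] at hs; exact ⟨by linarith [hs.1], by linarith [hs.2]⟩
      exact hMg _ (hγK ⟨s, hs', rfl⟩)
  -- assemble
  rw [dist_eq_norm]
  calc ‖(δ k : ℂ) * ∑ t ∈ Finset.range (N k), u k (P k t) - ∫ s in a₀..(a₀ + ℓ), g (p + (s : ℂ) * v)‖
      ≤ ‖(δ k : ℂ) * ∑ t ∈ Finset.range (N k), u k (P k t) - (δ k : ℂ) * ∑ t ∈ Finset.range (N k), g (P k t)‖ +
        ‖(δ k : ℂ) * ∑ t ∈ Finset.range (N k), g (P k t) - (δ k : ℂ) * ∑ t ∈ Finset.range (N k), f (a₀ + t * δ k)‖ +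
        ‖(δ k : ℂ) * ∑ t ∈ Finset.range (N k), f (a₀ + t * δ k) - ∫ s in a₀..(a₀ + N k * δ k), f s‖ +
        ‖(∫ s in a₀..(a₀ + N k * δ k), f s) - ∫ s in a₀..(a₀ + ℓ), f s‖ := by
          have t1 := norm_sub_le_norm_sub_add_norm_sub ((δ k : ℂ) * ∑ t ∈ Finset.range (N k), u k (P k t))
            ((δ k : ℂ) * ∑ t ∈ Finset.range (N k), g (P k t)) (∫ s in a₀..(a₀ + ℓ), f s)
          have t2 := norm_sub_le_norm_sub_add_norm_sub ((δ k : ℂ) * ∑ t ∈ Finset.range (N k), g (P k t))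
            ((δ k : ℂ) * ∑ t ∈ Finset.range (N k), f (a₀ + t * δ k)) (∫ s in a₀..(a₀ + ℓ), f s)
          have t3 := norm_sub_le_norm_sub_add_norm_sub ((δ k : ℂ) * ∑ t ∈ Finset.range (N k), f (a₀ + t * δ k))
            (∫ s in a₀..(a₀ + N k * δ k), f s) (∫ s in a₀..(a₀ + ℓ), f s)
          simp only [hf, hγ] at t1 t2 t3 ⊢
          linarith
    _ ≤ (N k * δ k) * ε' + (N k * δ k) * ε' + (N k * δ k) * ε' + Mg * ε' := by
        linarith [step1, step2, step3, step4]
    _ ≤ (ℓ + 1) * ε' + (ℓ + 1) * ε' + (ℓ + 1) * ε' + Mg * ε' := by gcongr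
    _ < ε := by
        rw [hε']
        have hden : 0 < 4 * (ℓ + 2) + 4 * (Mg + 1) := by positivity
        rw [← sub_pos]
        field_simp
        nlinarith

end Literature.Probability.LatticeModels
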